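import Literature.AnabelianGeometry.AbsoluteAnabelian.AbsTopIII.ReconstructionCor110iiPrimeNaturalProofs
import Literature.AnabelianGeometry.AbsoluteAnabelian.ReconstructionCor110OpenFunctoriality
import Literature.AnabelianGeometry.AbsoluteAnabelian.GaloisCyclotomeRestrictionCompatHolds
import Literature.NumberTheory.GaloisRepresentations.LocalGaloisGroupProofs
import Literature.NumberTheory.GaloisRepresentations.LocalGaloisGroupInertiaProofs
import HarnessLib

/-!
# [AbsTopIII] Cor. 1.10 (i)(b): natural in isomorphisms AND open injections — the packaged family

Mochizuki, *Topics in Absolute Anabelian Geometry III*, Cor. 1.10 (i)(b) p. 42: the natural isomorphism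
`H¹(G_k, μ_Ẑ(G_k)) ⥲ G_k^ab` is functorial «with respect to arbitrary injective open homomorphisms of
profinite groups»; for an open injection `G_{k′} ↪ G_k` the induced map `G_k^ab → G_{k′}^ab` is the
Verlagerung ([AbsAnab] Prop. 1.2.1 (vi)/(vii), p. 11 «by considering the Verlagerung»).

WHY THIS FILE (abc-iut layer L4, rows «Cor110ib-NAT» / «COR110ib-OPEN»; abc-iut-L4-d3).  PROOF-ONLY (no
definition, no named fact).  The tree holds the two halves separately: the ISOMORPHISM case for THE
family `j_k = H¹(i_k) ≫ (H¹(G_k, Ẑ(1)) ≃ (kˣ)^∧) ≫ e_k` (abc-iut-L4-d3 `AbsTopIII.cor_1_10_i_b_natural_holds`,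
an `∃ j` statement, components `Cor110Nat.exists_family_components`) and the OPEN-INJECTIVE square for
members built from restriction-compatible cyclotome identifications (abc-iut-L4-t11
`reciprocityIso_galCyclotomeRes`, `ReconstructionCor110OpenFunctoriality.lean`).  Since an `∃`-statement
does not name its witness, the two cannot be combined from outside; this file re-opens the components
and packages ONE family with all three clauses:

* `Cor110Nat.reciprocityIso_natural_of_components` — clause (2) (naturality in isomorphisms
  `α : G_{k₁} ≃ₜ* G_{k₂}`) for the member expression at given components `(D, e)` satisfying the
  `α`-transport clause of `exists_family_components` (the argument of `cor_1_10_i_b_natural_holds`,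
  factored as a lemma);
* `Cor110Nat.coe_equiv_symm_eq_of_compatible` — the pointwise restriction-compatibility
  `φ′ = inducedCyclotomeEquiv k k′ φ` gives abc-iut-L4-t11's values-in-`k̄′` binder `hcompat`;
* `AbsTopIII.cor_1_10_i_b_resNatural_of_compatible` — **if THE characterised identifications are
  restriction-compatible along every finite extension of MLFs, then ONE family `j` satisfies
  (1) `j_k ∘ H¹(φ_k)⁻¹ ∘ κ̂` is a local reciprocity map, (2) `j_{k₂} ∘ H¹(α) = α^{ab} ∘ j_{k₁}` for every
  isomorphism `α`, and (3) `j_{k′} (Res x) = Ver_{k′/k} (j_k x)` for every finite `k′/k`** — the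
  instance binders of abc-iut-L4-t11's square (`Algebra.IsSeparable`, `ValuativeExtension`) being
  discharged in characteristic `0` by perfectness and automatic continuity
  (`valuativeExtension_of_cast_residueFieldCard_eq_zero`).

The one hypothesis is abc-iut-L4-t11's file F ([AbsAnab] Prop. 1.2.1 (vi)); with it the theorem is the
unconditional natural-and-open form of Cor. 1.10 (i)(b).  HONEST FRAMING: classical local class field
theory and Kummer theory; nothing here bears on [IUTchIII] Cor. 3.12.
-/

noncomputable section

open CategoryTheory Function
open Field IsNonarchimedeanLocalField ValuativeRel
open ProfiniteGrp ProfiniteGrp.ProfiniteCompletion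

namespace Literature.AnabelianGeometry.AbsoluteAnabelian

open _root_.TopRep _root_.ContRepresentation _root_.ContinuousCohomology
open Literature.NumberTheory.GaloisRepresentations
open Literature.NumberTheory.GaloisRepresentations.IsNonarchimedeanLocalField
open Literature.NumberTheory.GaloisRepresentations.DiscreteGaloisModule
open Literature.NumberTheory.GaloisRepresentations.LocalWeilDatum

namespace Cor110Nat

/-! ### Pointwise compatibility ⇒ the values binder -/

section Compat

variable {k k' : Type} [Field k] [CharZero k] [Field k'] [CharZero k'] [Algebra k k'] [FiniteDimensional k k']
  (φ : muQZ (absoluteGaloisGroup k) ≃+ Additive (CommGroup.torsion (AlgebraicClosure k)ˣ))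
  (φ' : muQZ (absoluteGaloisGroup k') ≃+ Additive (CommGroup.torsion (AlgebraicClosure k')ˣ))

/-- Pointwise restriction-compatibility `φ′ = inducedCyclotomeEquiv k k′ φ` gives abc-iut-L4-t11's binder
`hcompat` (`φ′ ∘ μ_{ℚ/ℤ}(res)⁻¹ = ι ∘ φ` on values in `k̄′`). [cite: MochizukiAbsTopIII2015, Cor 1.10 (i) p.42] -/
theorem coe_equiv_symm_eq_of_compatible (hres : ∀ x : muQZ (absoluteGaloisGroup k'), φ' x = inducedCyclotomeEquiv k k' φ x)
    (z : muQZ (absoluteGaloisGroup k)) :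
    (((Additive.toMul (φ' ((muQZ.mapOfOpenEmbedding (absGaloisRestrict k k')
        (absGaloisRestrict_injective k k') (isOpen_range_absGaloisRestrict k k')).symm z)) :
        CommGroup.torsion (AlgebraicClosure k')ˣ) : (AlgebraicClosure k')ˣ) : AlgebraicClosure k') =
      absClosureEmbedding k k' ((((Additive.toMul (φ z)) : CommGroup.torsion (AlgebraicClosure k)ˣ) :
        (AlgebraicClosure k)ˣ) : AlgebraicClosure k) := by
  rw [hres, inducedCyclotomeEquiv_apply, AddEquiv.apply_symm_apply, coe_toMul_torsionUnitsTransport]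

end Compat

/-! ### Clause (2) at given components -/

section Natural

variable (D : ∀ (k : Type) [Field k] [ValuativeRel k] [TopologicalSpace k] [IsNonarchimedeanLocalField k]
    [CharZero k], TorsionReciprocityData k)
  (e : ∀ (k : Type) [Field k] [ValuativeRel k] [TopologicalSpace k] [IsNonarchimedeanLocalField k]
    [CharZero k], completion (GrpCat.of kˣ) ≃ₜ* absoluteGaloisGroupAbelianization k)
  {k₁ : Type} [Field k₁] [ValuativeRel k₁] [TopologicalSpace k₁] [IsNonarchimedeanLocalField k₁] [CharZero k₁]
  {k₂ : Type} [Field k₂] [ValuativeRel k₂] [TopologicalSpace k₂] [IsNonarchimedeanLocalField k₂] [CharZero k₂]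
  (α : absoluteGaloisGroup k₁ ≃ₜ* absoluteGaloisGroup k₂)
  (hnat : ∀ (ψ : (AlgebraicClosure k₁)ˣ ≃* (AlgebraicClosure k₂)ˣ),
    Prop121vii.IsAlphaEquivariant α ψ → Prop121vii.PreservesUniformizers ψ →
    (∀ z : muQZ (absoluteGaloisGroup k₁),
      Additive.toMul ((D k₂).muLift (muQZ.map α z)) = ψ (Additive.toMul ((D k₁).muLift z))) ∧
    ∀ {f : k₁ˣ →* k₂ˣ},
      (∀ u : k₁ˣ, Units.map (algebraMap k₂ (AlgebraicClosure k₂) : k₂ →* AlgebraicClosure k₂) (f u) =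
        ψ (Units.map (algebraMap k₁ (AlgebraicClosure k₁) : k₁ →* AlgebraicClosure k₁) u)) →
      ∀ {Ψ : completion (GrpCat.of k₁ˣ) →ₜ* completion (GrpCat.of k₂ˣ)},
        (∀ u : k₁ˣ, Ψ (etaFn (GrpCat.of k₁ˣ) u) = etaFn (GrpCat.of k₂ˣ) (f u)) →
        ∀ x : completion (GrpCat.of k₁ˣ), e k₂ (Ψ x) = abelianizationCongr α (e k₁ x))

include hnat in
/-- **Clause (2) at components**: if along `α : G_{k₁} ≃ₜ* G_{k₂}` the data `D` are transported by every
`α`-equivariant uniformiser-preserving `ψ̄` and the completed reciprocity isomorphisms `e` intertwine the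
completion of `ψ̄|_{k₁ˣ}` with `α^{ab}` (the `α`-clause of `Cor110Nat.exists_family_components`), then the
member `j_k = H¹(i_k) ≫ (H¹(G_k, Ẑ(1)) ≃ (kˣ)^∧) ≫ e_k` satisfies `j_{k₂} (H¹(α; μ_Ẑ(α)) x) = α^{ab} (j_{k₁} x)`
— the argument of `AbsTopIII.cor_1_10_i_b_natural_holds` (THE units transport, cyclotome square, Kummer
square at every level, glued on `(k₂ˣ)^∧`-coordinates). [cite: MochizukiAbsTopIII2015, Cor 1.10 (i) p.42] -/
theorem reciprocityIso_natural_of_components (x : galCyclotomeH1 (absoluteGaloisGroup k₁)) :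
    (((AddEquiv.mk' (continuousCohomologyEquivOfIso
            (galCyclotomeIsoTateModule k₂ (D k₂).equiv (D k₂).equiv_smul) 1)
          fun x y => map_add (cohomologyMap (galCyclotomeIsoTateModule k₂ (D k₂).equiv
            (D k₂).equiv_smul).hom 1).hom x y).trans
        (continuousCohomologyOneTateModuleEquivCompletion k₂
          (Cor110iiPrime.finiteIndex_range_powMonoidHom k₂))).trans
      (MulEquiv.toAdditive (e k₂).toMulEquiv)) (galCyclotomeH1Map α x) =
    Additive.ofMul (abelianizationCongr α (Additive.toMul
      ((((AddEquiv.mk' (continuousCohomologyEquivOfIso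
              (galCyclotomeIsoTateModule k₁ (D k₁).equiv (D k₁).equiv_smul) 1)
            fun x y => map_add (cohomologyMap (galCyclotomeIsoTateModule k₁ (D k₁).equiv
              (D k₁).equiv_smul).hom 1).hom x y).trans
          (continuousCohomologyOneTateModuleEquivCompletion k₁
            (Cor110iiPrime.finiteIndex_range_powMonoidHom k₁))).trans
        (MulEquiv.toAdditive (e k₁).toMulEquiv)) x))) := by
  classical
  -- THE units transport along `α` and its restriction `f : k₁ˣ ≃* k₂ˣ`, completed to `Ψ`
  obtain ⟨ψ, hψ, -, hU⟩ := Prop121vii.unitsTransport_holds k₁ k₂ α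
  obtain ⟨f₀, hf₀⟩ := hψ.exists_unitsMulEquiv
  set f : k₁ˣ →* k₂ˣ := f₀.toMonoidHom with hfdef
  have hf : ∀ u : k₁ˣ, Units.map (algebraMap k₂ (AlgebraicClosure k₂) : k₂ →* AlgebraicClosure k₂) (f u) =
      ψ (Units.map (algebraMap k₁ (AlgebraicClosure k₁) : k₁ →* AlgebraicClosure k₁) u) := fun u => hf₀ u
  set Ψ : completion (GrpCat.of k₁ˣ) →ₜ* completion (GrpCat.of k₂ˣ) :=
    (ProfiniteGrp.ProfiniteCompletion.lift (GrpCat.ofHom f ≫ eta (GrpCat.of k₂ˣ))).hom with hΨdef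
  have hΨ : ∀ u : k₁ˣ, Ψ (etaFn (GrpCat.of k₁ˣ) u) = etaFn (GrpCat.of k₂ˣ) (f u) := fun u =>
    lift_comp_eta_apply f u
  obtain ⟨hμ, hsq⟩ := hnat ψ hψ hU
  -- abbreviations
  set hfin₁ := Cor110iiPrime.finiteIndex_range_powMonoidHom k₁
  set hfin₂ := Cor110iiPrime.finiteIndex_range_powMonoidHom k₂
  set i₁ := galCyclotomeIsoTateModule k₁ (D k₁).equiv (D k₁).equiv_smul with hi₁
  set i₂ := galCyclotomeIsoTateModule k₂ (D k₂).equiv (D k₂).equiv_smul with hi₂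
  -- the class `x = [c]` and its transports
  obtain ⟨c, rfl⟩ := oneCocycleClass_surjective _ x
  set c' := contOneCocycles.pullback (α.symm : absoluteGaloisGroup k₂ →ₜ* absoluteGaloisGroup k₁)
    (galCyclotomeResHom α) c with hc'
  set d₁ := contOneCocycles.pullback (ContinuousMonoidHom.id (absoluteGaloisGroup k₁)) (resIdHom i₁.hom) c
    with hd₁
  set d₂ := contOneCocycles.pullback (ContinuousMonoidHom.id (absoluteGaloisGroup k₂)) (resIdHom i₂.hom) c'
    with hd₂
  -- unfold the two members of the family on the classes
  change Additive.ofMul (e k₂ (Additive.toMul (continuousCohomologyOneTateModuleEquivCompletion k₂ hfin₂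
      ((cohomologyMap i₂.hom 1).hom (galCyclotomeH1Map α (oneCocycleClass _ c)))))) =
    Additive.ofMul (abelianizationCongr α (e k₁ (Additive.toMul
      (continuousCohomologyOneTateModuleEquivCompletion k₁ hfin₁ ((cohomologyMap i₁.hom 1).hom
        (oneCocycleClass _ c))))))
  rw [galCyclotomeH1Map_oneCocycleClass, ← hc']
  have e₂cl : (cohomologyMap i₂.hom 1).hom (oneCocycleClass _ c') = oneCocycleClass _ d₂ :=
    cohomologyMap_oneCocycleClass i₂.hom c'
  have e₁cl : (cohomologyMap i₁.hom 1).hom (oneCocycleClass _ c) = oneCocycleClass _ d₁ :=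
    cohomologyMap_oneCocycleClass i₁.hom c
  rw [e₂cl, e₁cl]
  set y := Additive.toMul (continuousCohomologyOneTateModuleEquivCompletion k₁ hfin₁ (oneCocycleClass _ d₁))
    with hy
  rw [← hsq hf hΨ y]
  congr 2
  -- the `(k₂ˣ)^∧`-coordinates agree: Kummer square at every level `n`
  refine PowCompletion.ext_of_proj hfin₂ fun n => ?_
  rw [proj_completionHom_eq hfin₁ hfin₂ f hΨ n y]
  obtain ⟨a, ha⟩ := QuotientGroup.mk_surjective (PowCompletion.proj hfin₁ n y)
  rw [← ha]
  change _ = QuotientGroup.mk (f a)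
  apply (kummerLift_bijective k₂ n).1
  rw [kummerLift_proj_equivCompletion k₂ hfin₂, kummerLift_mk,
    DiscreteInvSystem.cohomologyMap_projHom_oneCocycleClass]
  -- level `n`: `[proj_n d₁] = δ_n(a)`
  have h₁ : oneCocycleClass _ ((muSystem k₁).projCocycle₁ n d₁) =
      Multiplicative.toAdd (kummerMap k₁ n a) := by
    have h := kummerLift_proj_equivCompletion k₁ hfin₁ (oneCocycleClass _ d₁) n
    rw [← hy, ← ha, kummerLift_mk, DiscreteInvSystem.cohomologyMap_projHom_oneCocycleClass] at h
    rw [h, toAdd_ofAdd]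
  -- the transported Tate cocycles are `ψ̄`-related levelwise (cyclotome square)
  have h₂ : ∀ σ' : absoluteGaloisGroup k₂,
      muVal k₂ n (((muSystem k₂).projCocycle₁ n d₂).1 σ') =
        ψ (muVal k₁ n (((muSystem k₁).projCocycle₁ n d₁).1 (α.symm σ'))) := fun σ' => by
    rw [DiscreteInvSystem.projCocycle₁_apply, DiscreteInvSystem.projCocycle₁_apply, hd₂, hd₁, hc']
    exact muVal_tateCocycle_transport (D k₁) (D k₂) α ψ hμ c σ' n
  rw [oneCocycleClass_transport_eq_kummerMap α hψ n (hf a).symm ((muSystem k₁).projCocycle₁ n d₁) h₁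
    ((muSystem k₂).projCocycle₁ n d₂) h₂, ofAdd_toAdd]

end Natural

end Cor110Nat

/-! ### The packaged family: (1) ∧ (2) ∧ (3) -/

namespace AbsTopIII

/-- **[AbsTopIII] Cor. 1.10 (i)(b), natural in isomorphisms AND in open injections — ONE family**, from
the restriction-compatibility of THE characterised identifications (abc-iut-L4-t11's file F, [AbsAnab]
Prop. 1.2.1 (vi)): there is a family `j_k : H¹(G_k, μ_Ẑ(G_k)) ≃+ G_k^ab` over the MLFs `k : Type` with
(1) `j_k ∘ H¹(φ_k)⁻¹ ∘ κ̂` a local reciprocity map (some equivariant `φ_k`), (2)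
`j_{k₂} (H¹(α; μ_Ẑ(α)) x) = α^{ab} (j_{k₁} x)` for EVERY isomorphism of topological groups `α`, and (3)
`j_{k′} (Res x) = Ver_{k′/k} (j_k x)` for EVERY finite extension `k′/k` (`Res = galCyclotomeRes k k′ 1`,
abc-iut-w5-d201; `Ver = verlagerung k k′`).  Witness: THE family of `cor_1_10_i_b_natural_holds`
(components `Cor110Nat.exists_family_components`); (3) is abc-iut-L4-t11's `reciprocityIso_galCyclotomeRes`.
[cite: MochizukiAbsTopIII2015, Cor 1.10 (i) p.42] -/
theorem cor_1_10_i_b_resNatural_of_compatible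
    (hres : ∀ (k : Type) [Field k] [ValuativeRel k] [TopologicalSpace k] [IsNonarchimedeanLocalField k]
      [CharZero k] (k' : Type) [Field k'] [ValuativeRel k'] [TopologicalSpace k']
      [IsNonarchimedeanLocalField k'] [CharZero k'] [Algebra k k'] [FiniteDimensional k k']
      (x : muQZ (absoluteGaloisGroup k')),
      (exists_torsionReciprocityData_levelChar k').choose.equiv x =
        inducedCyclotomeEquiv k k' (exists_torsionReciprocityData_levelChar k).choose.equiv x) :
    ∃ j : ∀ (k : Type) [Field k] [ValuativeRel k] [TopologicalSpace k] [IsNonarchimedeanLocalField k]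
        [CharZero k],
        galCyclotomeH1 (absoluteGaloisGroup k) ≃+ Additive (absoluteGaloisGroupAbelianization k),
      (∀ (k : Type) [Field k] [ValuativeRel k] [TopologicalSpace k] [IsNonarchimedeanLocalField k]
        [CharZero k],
        ∃ (φ : muQZ (absoluteGaloisGroup k) ≃+ Additive (CommGroup.torsion (AlgebraicClosure k)ˣ))
          (hφ : ∀ (σ : absoluteGaloisGroup k) (x : muQZ (absoluteGaloisGroup k)),
            (((Additive.toMul (φ (σ • x)) : CommGroup.torsion (AlgebraicClosure k)ˣ) :
                (AlgebraicClosure k)ˣ) : AlgebraicClosure k) =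
              σ • (((Additive.toMul (φ x) : CommGroup.torsion (AlgebraicClosure k)ˣ) :
                (AlgebraicClosure k)ˣ) : AlgebraicClosure k)),
          IsLocalReciprocityMap k (reciprocityOfContainerIso hφ (j k))) ∧
      (∀ (k₁ : Type) [Field k₁] [ValuativeRel k₁] [TopologicalSpace k₁] [IsNonarchimedeanLocalField k₁]
        [CharZero k₁]
        (k₂ : Type) [Field k₂] [ValuativeRel k₂] [TopologicalSpace k₂] [IsNonarchimedeanLocalField k₂]
        [CharZero k₂]
        (α : absoluteGaloisGroup k₁ ≃ₜ* absoluteGaloisGroup k₂) (x : galCyclotomeH1 (absoluteGaloisGroup k₁)),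
        j k₂ (galCyclotomeH1Map α x) = Additive.ofMul (abelianizationCongr α (Additive.toMul (j k₁ x)))) ∧
      ∀ (k : Type) [Field k] [ValuativeRel k] [TopologicalSpace k] [IsNonarchimedeanLocalField k] [CharZero k]
        (k' : Type) [Field k'] [ValuativeRel k'] [TopologicalSpace k'] [IsNonarchimedeanLocalField k']
        [CharZero k'] [Algebra k k'] [FiniteDimensional k k'] (x : galCyclotomeH1 (absoluteGaloisGroup k)),
        j k' ((galCyclotomeRes k k' 1).hom x) = Additive.ofMul
          (Literature.NumberTheory.GaloisRepresentations.verlagerung k k' (Additive.toMul (j k x))) := by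
  classical
  obtain ⟨D, e, hD, he, hrec, hnat⟩ := Cor110Nat.exists_family_components
  refine ⟨fun k _ _ _ _ _ =>
    ((AddEquiv.mk' (continuousCohomologyEquivOfIso
          (galCyclotomeIsoTateModule k (D k).equiv (D k).equiv_smul) 1)
        fun x y => map_add (cohomologyMap (galCyclotomeIsoTateModule k (D k).equiv (D k).equiv_smul).hom 1).hom
          x y).trans
      (continuousCohomologyOneTateModuleEquivCompletion k (Cor110iiPrime.finiteIndex_range_powMonoidHom k))).trans
      (MulEquiv.toAdditive (e k).toMulEquiv), fun k _ _ _ _ _ => ?_, fun k₁ _ _ _ _ _ k₂ _ _ _ _ _ α x => ?_,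
    fun k _ _ _ _ _ k' _ _ _ _ _ _ _ x => ?_⟩
  · -- clause (1): reading (D) for the member `j_k`, with `φ := (D k).equiv`
    refine ⟨(D k).equiv, (D k).equiv_smul, ?_⟩
    rw [Cor110iiPrime.reciprocityOfContainerIso_eq k (Cor110iiPrime.finiteIndex_range_powMonoidHom k)
      (D k).equiv (D k).equiv_smul (e k)]
    exact hrec k
  · -- clause (2): naturality in isomorphisms
    exact Cor110Nat.reciprocityIso_natural_of_components D e α (fun ψ hψ hU => hnat k₁ k₂ α ψ hψ hU) x
  · -- clause (3): the open injection `G_{k′} ↪ G_k` (abc-iut-L4-t11's square), instances discharged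
    haveI : ValuativeExtension k k' :=
      valuativeExtension_of_cast_residueFieldCard_eq_zero cast_residueFieldCard_eq_zero_of_algebra
    haveI : ValuativeExtension k k := ⟨fun _ _ => Iff.rfl⟩
    haveI : ValuativeExtension k' k' := ⟨fun _ _ => Iff.rfl⟩
    have hres' : ∀ y : muQZ (absoluteGaloisGroup k'), (D k').equiv y = inducedCyclotomeEquiv k k' (D k).equiv y := by
      intro y
      rw [hD k, hD k']
      exact hres k k' y
    exact reciprocityIso_galCyclotomeRes k k' (D k).equiv (D k).equiv_smul (D k').equiv (D k').equiv_smul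
      (Cor110Nat.coe_equiv_symm_eq_of_compatible _ _ hres') (he k) (he k') x

/-- **[AbsTopIII] Cor. 1.10 (i)(b), natural in isomorphisms AND in open injections — unconditional.**
There is ONE family `j_k : H¹(G_k, μ_Ẑ(G_k)) ≃+ G_k^ab` over the MLFs `k : Type` (characteristic `0`) with
(1) `j_k ∘ H¹(φ_k)⁻¹ ∘ κ̂` a local reciprocity map, (2) `j_{k₂} (H¹(α; μ_Ẑ(α)) x) = α^{ab} (j_{k₁} x)` for every
isomorphism of topological groups `α : G_{k₁} ≃ₜ* G_{k₂}`, and (3) `j_{k′} (Res x) = Ver_{k′/k} (j_k x)` for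
every finite extension `k′/k` («functorial with respect to arbitrary injective open homomorphisms of
profinite groups», p. 42; every injective open `β : H ↪ G_k` factors as `Inn(g) ∘ res ∘ iso`,
`exists_eq_conj_absGaloisRestrict_comp`).  `cor_1_10_i_b_resNatural_of_compatible` with its hypothesis
discharged by the restriction-compatibility of THE characterised identifications ([AbsAnab] Prop. 1.2.1 (vi);
abc-iut-L4-t11, file F: `Cor110Open.levelChar_equiv_eq_inducedCyclotomeEquiv`).
[cite: MochizukiAbsTopIII2015, Cor 1.10 (i) p.42] -/
theorem cor_1_10_i_b_resNatural_holds :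
    ∃ j : ∀ (k : Type) [Field k] [ValuativeRel k] [TopologicalSpace k] [IsNonarchimedeanLocalField k]
        [CharZero k],
        galCyclotomeH1 (absoluteGaloisGroup k) ≃+ Additive (absoluteGaloisGroupAbelianization k),
      (∀ (k : Type) [Field k] [ValuativeRel k] [TopologicalSpace k] [IsNonarchimedeanLocalField k]
        [CharZero k],
        ∃ (φ : muQZ (absoluteGaloisGroup k) ≃+ Additive (CommGroup.torsion (AlgebraicClosure k)ˣ))
          (hφ : ∀ (σ : absoluteGaloisGroup k) (x : muQZ (absoluteGaloisGroup k)),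
            (((Additive.toMul (φ (σ • x)) : CommGroup.torsion (AlgebraicClosure k)ˣ) :
                (AlgebraicClosure k)ˣ) : AlgebraicClosure k) =
              σ • (((Additive.toMul (φ x) : CommGroup.torsion (AlgebraicClosure k)ˣ) :
                (AlgebraicClosure k)ˣ) : AlgebraicClosure k)),
          IsLocalReciprocityMap k (reciprocityOfContainerIso hφ (j k))) ∧
      (∀ (k₁ : Type) [Field k₁] [ValuativeRel k₁] [TopologicalSpace k₁] [IsNonarchimedeanLocalField k₁]
        [CharZero k₁]
        (k₂ : Type) [Field k₂] [ValuativeRel k₂] [TopologicalSpace k₂] [IsNonarchimedeanLocalField k₂]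
        [CharZero k₂]
        (α : absoluteGaloisGroup k₁ ≃ₜ* absoluteGaloisGroup k₂) (x : galCyclotomeH1 (absoluteGaloisGroup k₁)),
        j k₂ (galCyclotomeH1Map α x) = Additive.ofMul (abelianizationCongr α (Additive.toMul (j k₁ x)))) ∧
      ∀ (k : Type) [Field k] [ValuativeRel k] [TopologicalSpace k] [IsNonarchimedeanLocalField k] [CharZero k]
        (k' : Type) [Field k'] [ValuativeRel k'] [TopologicalSpace k'] [IsNonarchimedeanLocalField k']
        [CharZero k'] [Algebra k k'] [FiniteDimensional k k'] (x : galCyclotomeH1 (absoluteGaloisGroup k)),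
        j k' ((galCyclotomeRes k k' 1).hom x) = Additive.ofMul
          (Literature.NumberTheory.GaloisRepresentations.verlagerung k k' (Additive.toMul (j k x))) :=
  cor_1_10_i_b_resNatural_of_compatible fun k _ _ _ _ _ k' _ _ _ _ _ _ _ x =>
    Cor110Open.levelChar_equiv_eq_inducedCyclotomeEquiv k k' x

end AbsTopIII

end Literature.AnabelianGeometry.AbsoluteAnabelian
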